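import Literature.MathematicalPhysics.QuantumFieldTheory.Balaban1983to89.B9Eq3132CoerciveFromGA
import Literature.MathematicalPhysics.QuantumFieldTheory.Balaban1983to89.B9BackgroundsKLevelV1R

/-!
# `Balaban1983to89.B9Eq3132CoerciveFromGAR` — T. Bałaban, *Propagators for lattice gauge theories in a background field*, Commun. Math. Phys. **99** (1985)
# 389–434 [Balaban1985BackgroundPropagators], (3.132) p. 422 under Theorem 3.12's prefix p. 423: ROW 26's COERCIVITY TRANSFER RE-PRESSED ONCE OVER THE
# CLASS-PARAMETRIC CARRIER `bg9YR 𝔸 G R₁ R₂` (CASCADE-R STEP 2, n06-i share; the R-twins of `B9Eq3132StepDifference.subMajorants_of_step12` and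
# `B9Eq3132CoerciveFromGA.coerciveUnder_of_subMajorants`)

[4] = T. Bałaban, *Propagators and renormalization transformations for lattice gauge theories. II*, Commun. Math. Phys. **96** (1984) 223–250 [`Balaban1984PropagatorsII`].

statement-level skeleton of published theorems with citation tags; proofs where landed; nothing here is a claim about the Yang–Mills mass gap

THE PRINT.  [B9] p. 421 (3.130) *«G = G₀(I − Δ′_πG₀)⁻¹ = Σ_{n=0}^∞ G₀(Δ′_πG₀)ⁿ»*, p. 422 *«each operator Δ′_π provides the small factor α₀ … The operators (QG̃Q*)⁻¹, or
(QG₁Q*)⁻¹, can be analyzed in the same way as the operator (Q′G′²Q′*)⁻¹ … (3.132)»*, p. 423 (3.138) and Theorem 3.12 (prefix: (3.35), (3.36), α₀ small); p. 396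
(3.35) *«U with values in G»*; [4] (2.147) p. 249, (2.142) p. 248, Lemma 2.1 (2.60)–(2.61) p. 234.

WHY THIS FILE (dag-n06-i gen 21; dag-n06-d g12 STEP-3 FACE CENSUS «`s3132Nu_opsYSectE_of_step12` [n06-i]: `bg9Y`-PINNED ✗»; node00-def-Y g23 RULING (α1)).
The second layer of row 26's supplier chain: the `(Mα₀)`-small difference majorants of `G_D − G₀`, `G₁ − G₀` from ROW 20's displayed inputs, and the transfer of
Λ²-coercivity from `Q T₀(U) Q*` to `Q T(U) Q*` along them.  As in `B9Eq3132DecayFromMajorantR`: the walk-model objects `𝔬 : Ops (geo9Y x) (bg9YR 𝔸 G R₁ R₂ x) …`,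
the pins and the premises are read at the carrier (its (3.35)∕(3.36) ARE the parameters `R₁ ∕ R₂`, `Iff.rfl`), the ONE class read (`G`-valuedness `hU.1.1`, for the
contractivity of the bond transporters) is DISPLAYED as def-Y's `MemOfFam G R₁`; proof texts otherwise verbatim; the class-blind lemmas underneath
(`hasMajorant_G_G1_of_step`, `hasMajorant_sub_of_fix`, `GcoK_sub`, `abs_normMatY_QGQOfY_le_of_hasMajorant`, `form_abs_le_of_entry_decay`, `rowSum261_geo9Y`,
`QGQInverse.coercive_of_form_perturbation`) are consumed BY NAME at `B := bg9YR 𝔸 G R₁ R₂ x`.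

WHAT IS PROVED (sorry-free, 0 def).
* §1 ★ `subMajorants_of_step12_R (R₁ R₂) …` — the [4]-(2.51) majorants `(2B₀cθ₁)·(Mα₀)·(Lʲη)²e^{−ρd}` of the coordinate models of `T − T₀` AND `T₁ − T₀` from the
  carrier-typed `hmodel` 5-conjunct shape at the pins `hblk hGco hG1co hG0co`; class-blind.
* §2 ★★ `coerciveUnder_of_subMajorants_R (R₁ R₂) (hG : MemOfFam G R₁) …` — `CoerciveUnder c35 geo (bg9YR 𝔸 G R₁ R₂) (Λ-normalised Q T₀ Q*)` + such difference
  majorants ⟹ `CoerciveUnder c35 geo (bg9YR 𝔸 G R₁ R₂) (Λ-normalised Q T Q*)` (constant γ∕2).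

HONEST SCOPE.  Re-typing bookkeeping (CASCADE-R STEP 2) of two LANDED derivations; the (3.35)∕(3.36) classes are PARAMETERS — the one class fact used is a
displayed hypothesis; Theorem 3.3 for `G₀`, (3.131), (3.137) and the identities remain ROW 20's displayed hypotheses; nothing of [B9] or [4] is asserted;
count-neutral; N06 NOT discharged; one finite 𝕋^{d+1} programme at fixed ε — nothing continuum, nothing OS, nothing about the mass gap.  Cell `pub-ymgap` (HUMAN
RULING D-0062), Track A node N06 [B9], seat `pub-ymgap-dag-n06-i` (gen 21), 2026-08-28; a NEW file (APPEND-ONLY companion of `B9Eq3132StepDifference` ∕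
`B9Eq3132CoerciveFromGA`, untouched).
-/

noncomputable section

namespace Literature.MathematicalPhysics.QuantumFieldTheory.Balaban1983to89.B9Eq3132CoerciveFromGAR

open B6RandomWalk (HasMajorant hasMajorant_mono)
open B9CoReadingCoords (XBK blkBK GcoK)
open B6Ineq2142KLevelV1 (lvl β)
open B9Eq3132StepDifference (hasMajorant_sub_of_fix GcoK_sub QGQOfY_sub normMatY_sub abs_normMatY_QGQOfY_le_of_hasMajorant)
open B9Eq3132DecayFromMajorant (hasMajorant_G_G1_of_step)
open B9Eq3132CoerciveFromGA (form_abs_le_of_entry_decay)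
open B9Thm39ReadingCoords (basisBound39)
open B9Eq3132RingInverseReading (normMatY dimConstY' dimConstY'_pos)
open Node00 (IBondY FBondY CfgY BondOpY BondParY QGQOfY)
open B6KLevelCensusIndexV1 (KIdx)
open B6GlobalChartV1 (blkV1)
open B9Thm34Ext (toB6)
open B9Thm312Whole (Ops Thm33G0 Step FormSmall Identities GeoOK)
open B9Thm312WholeLeaf (fix_of_inverses)
open B11SectG (RowSum)
open B9PinMembersKLevelV1 (MemberY geo9Y bg9Y)
open B9BackgroundsKLevelV1R (RegFamY bg9YR MemOfFam mem_of_reg335R)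
open B9GeoLemma21KLevelV1 (geo9K_len_pos rowSum261_geo9Y geo9Y_dist_comm)
open B9RWSumsReadsNbr (nbr)
open B9Eq3132NuReading (lamInvY)
open B9Eq3132CTInputs (CoerciveUnder)
open B9Eq3132ScalarIndex (geoComap)
open Matrix
open QGQInverse (Coercive coercive_of_form_perturbation)

variable {𝔸 : Type} [NormedRing 𝔸] [NormedAlgebra ℂ 𝔸]
variable {κ : Type} [Fintype κ] [DecidableEq κ] {Ff : Type} [Fintype Ff] [DecidableEq Ff]
variable {d ℓ : ℕ} {hd : 1 ≤ d + 1} {hL : Odd (ℓ + 1) ∧ 1 < ℓ + 1} {b₀ b₁ : ℝ} {Mstar : ℕ}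
variable [CompleteSpace 𝔸] [FiniteDimensional ℝ 𝔸] {G : Subgroup 𝔸ˣ}
variable (R₁ R₂ : RegFamY d ℓ hd hL b₀ b₁ Mstar 𝔸)

/-! ## §1 ★ The `(Mα₀)`-small difference majorants from ROW 20's displayed inputs, for a walk model over the class-parametric carrier -/

section FromStepFamily

variable {Y Z W : MemberY d ℓ hd hL b₀ b₁ Mstar → Type} [∀ x, Fintype (Z x)] [∀ x, Fintype (W x)]

/-- a small product: `0 ≤ t`, `m ≤ (2(t+1))⁻¹` ⇒ `t·m ≤ ½`. [folklore] -/
private theorem small_aux {t m : ℝ} (ht : 0 ≤ t) (hm : m ≤ (2 * (t + 1))⁻¹) : t * m ≤ 1 / 2 := by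
  have h1 : t * m ≤ t * (2 * (t + 1))⁻¹ := mul_le_mul_of_nonneg_left hm ht
  have h2 : t * (2 * (t + 1))⁻¹ ≤ 1 / 2 := by
    rw [← div_eq_mul_inv, div_le_iff₀ (by positivity)]
    nlinarith
  exact h1.trans h2

omit [DecidableEq κ] in
/-- ★ **THE FAMILY OF DIFFERENCE MAJORANTS FROM ROW 20's DISPLAYED INPUTS, FOR A WALK MODEL OVER THE CLASS-PARAMETRIC CARRIER** — the R-twin of
`B9Eq3132StepDifference.subMajorants_of_step12` (same proof text; `𝔬 : Ops (geo9Y x) (bg9YR 𝔸 G R₁ R₂ x) …`, pins `hblk hGco hG1co hG0co` and `hmodel` read at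
the carrier; class-blind): above `max(M₁, M_L)` and for `Mα₀ ≤ min(a₁, (2(θ₁c+1))⁻¹)`, the [4]-(2.51) majorants `(2B₀cθ₁)·(Mα₀)·(Lʲη)²e^{−ρd}` of the coordinate
models of `T − T₀` AND `T₁ − T₀` — the small factor `Mα₀` explicit.
[cite: Balaban1985BackgroundPropagators, Thm 3.12 p.423, (3.130)–(3.131) pp.421–422, (3.137)–(3.138) p.423, (3.35)–(3.36) p.396; Balaban1984PropagatorsII, (2.51) p.232, Lemma 2.1 (2.61) p.234] -/
theorem subMajorants_of_step12_R [∀ x : MemberY d ℓ hd hL b₀ b₁ Mstar, Fintype (geo9Y x).Site] (bK : Module.Basis κ ℝ 𝔸) {c35 : ℝ}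
    (𝔬 : ∀ x : MemberY d ℓ hd hL b₀ b₁ Mstar, Ops (geo9Y x) (bg9YR 𝔸 G R₁ R₂ x) (XBK κ x.toKIdx) (Y x) (Z x) (W x))
    (H₀ : MemberY d ℓ hd hL b₀ b₁ Mstar → Prop) (T T₁ T₀ : ∀ x : MemberY d ℓ hd hL b₀ b₁ Mstar, BondOpY 𝔸 x.toKIdx)
    {bI : ∀ x : MemberY d ℓ hd hL b₀ b₁ Mstar, FBondY x.toKIdx → IBondY x.toKIdx}
    (hblk : ∀ x, (𝔬 x).blk = blkBK x.toKIdx (bI x))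
    (hGco : ∀ (x : MemberY d ℓ hd hL b₀ b₁ Mstar) (U : (bg9YR 𝔸 G R₁ R₂ x).Cfg), (𝔬 x).G U = GcoK x.toKIdx bK (bg9YR 𝔸 G R₁ R₂ x) (fun U => U) (T x) U)
    (hG1co : ∀ (x : MemberY d ℓ hd hL b₀ b₁ Mstar) (U : (bg9YR 𝔸 G R₁ R₂ x).Cfg), (𝔬 x).G1 U = GcoK x.toKIdx bK (bg9YR 𝔸 G R₁ R₂ x) (fun U => U) (T₁ x) U)
    (hG0co : ∀ (x : MemberY d ℓ hd hL b₀ b₁ Mstar) (U : (bg9YR 𝔸 G R₁ R₂ x).Cfg), (𝔬 x).G0 U = GcoK x.toKIdx bK (bg9YR 𝔸 G R₁ R₂ x) (fun U => U) (T₀ x) U)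
    (θ₁ r₁ B₀ δ₀ δK σ ρ a₁ M₁ : ℝ) (hθ₁ : 0 ≤ θ₁) (hB₀ : 0 ≤ B₀) (hσ : 0 < σ) (hρ : 0 < ρ) (hρS : ρ ≤ δ₀) (hρδ : ρ + σ ≤ δK)
    (ha₁ : 0 < a₁) (hM₁ : 0 < M₁) (hgeo : ∀ x : MemberY d ℓ hd hL b₀ b₁ Mstar, GeoOK (geo9Y x))
    (hmodel : ∀ x : MemberY d ℓ hd hL b₀ b₁ Mstar, M₁ ≤ (geo9Y x).M → ∀ α₀ : ℝ, 0 < α₀ → (geo9Y x).M * α₀ ≤ a₁ →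
      ∀ U : (bg9YR 𝔸 G R₁ R₂ x).Cfg, (bg9YR 𝔸 G R₁ R₂ x).Reg335 c35 α₀ U → (bg9YR 𝔸 G R₁ R₂ x).Reg336 c35 α₀ U →
        Thm33G0 (𝔬 x) 1 (H₀ x) B₀ δ₀ U ∧
        Step (𝔬 x) 1 (H₀ x) (hgeo x).lenle 1 (θ₁ * ((geo9Y x).M * α₀)) δK U ∧
        Step (𝔬 x) 1 (H₀ x) (hgeo x).lenle 2 (θ₁ * ((geo9Y x).M * α₀)) δK U ∧
        FormSmall (𝔬 x) (r₁ * ((geo9Y x).M * α₀)) U ∧ Identities (𝔬 x) U) :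
    ∃ M₂ a₂ C δ : ℝ, 0 < M₂ ∧ 0 < a₂ ∧ 0 ≤ C ∧ 0 < δ ∧
      ∀ x : MemberY d ℓ hd hL b₀ b₁ Mstar, M₂ ≤ (geo9Y x).M → ∀ α₀ : ℝ, 0 < α₀ → (geo9Y x).M * α₀ ≤ a₂ →
        ∀ U : (bg9YR 𝔸 G R₁ R₂ x).Cfg, (bg9YR 𝔸 G R₁ R₂ x).Reg335 c35 α₀ U → (bg9YR 𝔸 G R₁ R₂ x).Reg336 c35 α₀ U →
          HasMajorant (g := toB6 (geo9Y x) 1 (H₀ x)) (blkBK x.toKIdx (bI x)) (GcoK x.toKIdx bK (bg9YR 𝔸 G R₁ R₂ x) (fun U => U) (T x - T₀ x) U)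
              (fun a a' => C * ((geo9Y x).M * α₀) * (geo9Y x).len a ^ 2 * Real.exp (-(δ * (geo9Y x).dist a a'))) ∧
            HasMajorant (g := toB6 (geo9Y x) 1 (H₀ x)) (blkBK x.toKIdx (bI x)) (GcoK x.toKIdx bK (bg9YR 𝔸 G R₁ R₂ x) (fun U => U) (T₁ x - T₀ x) U)
              (fun a a' => C * ((geo9Y x).M * α₀) * (geo9Y x).len a ^ 2 * Real.exp (-(δ * (geo9Y x).dist a a'))) := by
  -- (2.61) for the record geometry at rate σ, constant `max c 0`
  obtain ⟨ML, c, hrow0⟩ := rowSum261_geo9Y (d := d) (ℓ := ℓ) (hd := hd) (hL := hL) (b₀ := b₀) (b₁ := b₁) (Mstar := Mstar) σ hσ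
  set c' : ℝ := max c 0 with hc'
  have hc'0 : 0 ≤ c' := le_max_right _ _
  have hrow : ∀ x : MemberY d ℓ hd hL b₀ b₁ Mstar, ML ≤ (geo9Y x).M → RowSum (toB6 (geo9Y x) 1 (H₀ x)) σ c' :=
    fun x hM y => (hrow0 x hM y).trans (le_max_left _ _)
  set a₂ : ℝ := min a₁ (2 * (θ₁ * c' + 1))⁻¹ with ha₂
  have ha₂0 : 0 < a₂ := lt_min ha₁ (inv_pos.2 (by positivity))
  refine ⟨max M₁ ML, a₂, 2 * B₀ * c' * θ₁, ρ, lt_of_lt_of_le hM₁ (le_max_left _ _), ha₂0, by positivity, hρ, fun x hM α₀ hα₀ hMa U hU hU' => ?_⟩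
  have hM1 : M₁ ≤ (geo9Y x).M := (le_max_left _ _).trans hM
  have hMLx : ML ≤ (geo9Y x).M := (le_max_right _ _).trans hM
  have hMa1 : (geo9Y x).M * α₀ ≤ a₁ := hMa.trans (min_le_left _ _)
  obtain ⟨h33, _, hst, _, hI⟩ := hmodel x hM1 α₀ hα₀ hMa1 U hU hU'
  have hMα0 : 0 ≤ (geo9Y x).M * α₀ := mul_nonneg (hM₁.le.trans hM1) hα₀.le
  have hsmall : θ₁ * ((geo9Y x).M * α₀) * c' ≤ 1 / 2 := by
    have h := small_aux (t := θ₁ * c') (m := (geo9Y x).M * α₀) (by positivity) (hMa.trans (min_le_right _ _))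
    calc θ₁ * ((geo9Y x).M * α₀) * c' = θ₁ * c' * ((geo9Y x).M * α₀) := by ring
      _ ≤ 1 / 2 := h
  have hq : θ₁ * ((geo9Y x).M * α₀) * c' < 1 := lt_of_le_of_lt hsmall (by norm_num)
  have hθ : 0 ≤ θ₁ * ((geo9Y x).M * α₀) := mul_nonneg hθ₁ hMα0
  -- the majorants of `G`, `G₁` themselves (n06-l `entry0_of_step`, constant `B₀(1 − q)⁻¹`)
  obtain ⟨hGm, hG1m⟩ := hasMajorant_G_G1_of_step (hgeo x) (𝔬 x) (hrow x hMLx) hθ hB₀ hρ.le hρS hρδ hq h33 hst hI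
  have hq1 : 0 ≤ (1 - θ₁ * ((geo9Y x).M * α₀) * c')⁻¹ := inv_nonneg.mpr (by linarith)
  have hB' : 0 ≤ B₀ * (1 - θ₁ * ((geo9Y x).M * α₀) * c')⁻¹ := mul_nonneg hB₀ hq1
  -- the differences through the resolvent identities
  have hD := hasMajorant_sub_of_fix (hgeo x) (hrow x hMLx) hθ hB' hρ.le le_rfl hρδ hst.step hGm (fix_of_inverses hI.invG0' hI.invG)
  have hD1 := hasMajorant_sub_of_fix (hgeo x) (hrow x hMLx) hθ hB' hρ.le le_rfl hρδ hst.step1 hG1m (fix_of_inverses hI.invG0' hI.invG1)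
  -- the constant `θ₁(Mα₀)·B₀(1 − q)⁻¹·c′ ≤ (2B₀c′θ₁)·(Mα₀)`
  have hinv : (1 - θ₁ * ((geo9Y x).M * α₀) * c')⁻¹ ≤ 2 := by
    rw [inv_le_comm₀ (by linarith) (by norm_num)]
    linarith
  have hle : ∀ a a' : (geo9Y x).Site,
      θ₁ * ((geo9Y x).M * α₀) * (B₀ * (1 - θ₁ * ((geo9Y x).M * α₀) * c')⁻¹) * c' * (geo9Y x).len a ^ 2 * Real.exp (-(ρ * (geo9Y x).dist a a')) ≤
        2 * B₀ * c' * θ₁ * ((geo9Y x).M * α₀) * (geo9Y x).len a ^ 2 * Real.exp (-(ρ * (geo9Y x).dist a a')) := by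
    intro a a'
    have h0 : 0 ≤ (geo9Y x).len a ^ 2 * Real.exp (-(ρ * (geo9Y x).dist a a')) := by positivity
    have h1 : θ₁ * ((geo9Y x).M * α₀) * (B₀ * (1 - θ₁ * ((geo9Y x).M * α₀) * c')⁻¹) * c' ≤ 2 * B₀ * c' * θ₁ * ((geo9Y x).M * α₀) := by
      have h2 : B₀ * (1 - θ₁ * ((geo9Y x).M * α₀) * c')⁻¹ ≤ B₀ * 2 := mul_le_mul_of_nonneg_left hinv hB₀
      calc θ₁ * ((geo9Y x).M * α₀) * (B₀ * (1 - θ₁ * ((geo9Y x).M * α₀) * c')⁻¹) * c'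
          = (θ₁ * ((geo9Y x).M * α₀) * c') * (B₀ * (1 - θ₁ * ((geo9Y x).M * α₀) * c')⁻¹) := by ring
        _ ≤ (θ₁ * ((geo9Y x).M * α₀) * c') * (B₀ * 2) := mul_le_mul_of_nonneg_left h2 (by positivity)
        _ = 2 * B₀ * c' * θ₁ * ((geo9Y x).M * α₀) := by ring
    calc _ = (θ₁ * ((geo9Y x).M * α₀) * (B₀ * (1 - θ₁ * ((geo9Y x).M * α₀) * c')⁻¹) * c') *
          ((geo9Y x).len a ^ 2 * Real.exp (-(ρ * (geo9Y x).dist a a'))) := by ring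
      _ ≤ (2 * B₀ * c' * θ₁ * ((geo9Y x).M * α₀)) * ((geo9Y x).len a ^ 2 * Real.exp (-(ρ * (geo9Y x).dist a a'))) :=
          mul_le_mul_of_nonneg_right h1 h0
      _ = _ := by ring
  rw [hblk x] at hD hD1
  rw [hGco x U, hG0co x U, ← GcoK_sub] at hD
  rw [hG1co x U, hG0co x U, ← GcoK_sub] at hD1
  exact ⟨hasMajorant_mono (g := toB6 (geo9Y x) 1 (H₀ x)) _ hD hle, hasMajorant_mono (g := toB6 (geo9Y x) 1 (H₀ x)) _ hD1 hle⟩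

end FromStepFamily

/-! ## §2 ★★ The family transfer at the class-parametric carrier: `CoerciveUnder` from `T₀` to `T` along `(Mα₀)`-small difference majorants -/

section Transfer

/-- ★★ **`CoerciveUnder` TRANSFERS ALONG `(Mα₀)`-SMALL DIFFERENCE MAJORANTS, AT THE CLASS-PARAMETRIC CARRIER `bg9YR 𝔸 G R₁ R₂`** — the R-twin of
`B9Eq3132CoerciveFromGA.coerciveUnder_of_subMajorants` (same proof text; premises read at the carrier; the one class read — `G`-valuedness, for the
contractivity `hparG` of the bond transporters — is the displayed `hG : MemOfFam G R₁`): if the Λ-normalised `Q T₀(U) Q*` is coercive (constant γ) under the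
carrier's prefix and the coordinate models of `T − T₀` have [4]-(2.51) majorants `(C·Mα₀)(Lʲη)²e^{−δd}` there, then the Λ-normalised `Q T(U) Q*` is coercive with
constant γ∕2 above `max(M₄, M₂, M_L, (d+3)log L∕(δ(2L²−1)))` for `Mα₀ ≤ min(a₀, a₂, γ∕(2(K′+1)))`.
[cite: Balaban1985BackgroundPropagators, (3.132) p.422, Thm 3.12 p.423 (prefix), (3.130) p.421, (3.35)–(3.36) p.396; Balaban1984PropagatorsII, (2.147) p.249, (2.142) p.248, Lemma 2.1 (2.60)–(2.61) p.234] -/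
theorem coerciveUnder_of_subMajorants_R (hG : MemOfFam G R₁) [∀ x : MemberY d ℓ hd hL b₀ b₁ Mstar, Fintype (geo9Y x).Site]
    [∀ x : MemberY d ℓ hd hL b₀ b₁ Mstar, DecidableEq (geo9Y x).Site] (bK : Module.Basis κ ℝ 𝔸) (b : Module.Basis Ff ℝ 𝔸) {c35 : ℝ}
    (T T₀ : ∀ x : MemberY d ℓ hd hL b₀ b₁ Mstar, BondOpY 𝔸 x.toKIdx) (parB : ∀ x : MemberY d ℓ hd hL b₀ b₁ Mstar, BondParY 𝔸 x.toKIdx)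
    (hparG : ∀ (x : MemberY d ℓ hd hL b₀ b₁ Mstar) (U : CfgY 𝔸 x.toKIdx), (∀ μ y, U μ y ∈ G) →
      ∀ s s', ‖(parB x U s s' : 𝔸)‖ ≤ 1 ∧ ‖(((parB x U s s')⁻¹ : 𝔸ˣ) : 𝔸)‖ ≤ 1)
    {bI : ∀ x : MemberY d ℓ hd hL b₀ b₁ Mstar, FBondY x.toKIdx → IBondY x.toKIdx}
    (hlev : ∀ (x : MemberY d ℓ hd hL b₀ b₁ Mstar) (f : FBondY x.toKIdx), lvl x.hN x.D x.hk (bI x f) = (blkV1 x.hN x.D f).1.1)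
    (hβ1 : ∀ (x : MemberY d ℓ hd hL b₀ b₁ Mstar) (f : FBondY x.toKIdx), (B6Geom246MultiLevelTorus.geomT x.D).dist (β x.hN x.D x.hk (bI x f)) (blkV1 x.hN x.D f) ≤ 1)
    {mN : ℕ} (hnbr : ∀ (x : MemberY d ℓ hd hL b₀ b₁ Mstar) (y : (geo9Y x).Site), (nbr (geo9Y x) ((ℓ : ℝ) + 4) y).card ≤ mN)
    {R : MemberY d ℓ hd hL b₀ b₁ Mstar → ℝ} {H : MemberY d ℓ hd hL b₀ b₁ Mstar → Prop}
    (hco : CoerciveUnder c35 (fun x : MemberY d ℓ hd hL b₀ b₁ Mstar => geoComap (geo9Y x) (Prod.fst : (geo9Y x).Site × Ff → (geo9Y x).Site))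
      (bg9YR 𝔸 G R₁ R₂) (fun x U => normMatY b (lamInvY x.toKIdx) (QGQOfY x.toKIdx (parB x) (T₀ x) U)))
    (hsub : ∃ M₂ a₂ C δ : ℝ, 0 < M₂ ∧ 0 < a₂ ∧ 0 ≤ C ∧ 0 < δ ∧
      ∀ x : MemberY d ℓ hd hL b₀ b₁ Mstar, M₂ ≤ (geo9Y x).M → ∀ α₀ : ℝ, 0 < α₀ → (geo9Y x).M * α₀ ≤ a₂ →
        ∀ U : (bg9YR 𝔸 G R₁ R₂ x).Cfg, (bg9YR 𝔸 G R₁ R₂ x).Reg335 c35 α₀ U → (bg9YR 𝔸 G R₁ R₂ x).Reg336 c35 α₀ U →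
          HasMajorant (g := toB6 (geo9Y x) (R x) (H x)) (blkBK x.toKIdx (bI x)) (GcoK x.toKIdx bK (bg9YR 𝔸 G R₁ R₂ x) (fun U => U) (T x - T₀ x) U)
            (fun a a' => C * ((geo9Y x).M * α₀) * (geo9Y x).len a ^ 2 * Real.exp (-(δ * (geo9Y x).dist a a')))) :
    CoerciveUnder c35 (fun x : MemberY d ℓ hd hL b₀ b₁ Mstar => geoComap (geo9Y x) (Prod.fst : (geo9Y x).Site × Ff → (geo9Y x).Site))
      (bg9YR 𝔸 G R₁ R₂) (fun x U => normMatY b (lamInvY x.toKIdx) (QGQOfY x.toKIdx (parB x) (T x) U)) := by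
  obtain ⟨M₄, a₀, γ, hM₄, ha₀, hγ, hco⟩ := hco
  obtain ⟨M₂, a₂, C, δ, hM₂, ha₂, hC, hδ, hmaj⟩ := hsub
  -- (2.61) at rate δ/2 for the record geometry
  obtain ⟨ML, c, hrow0⟩ := rowSum261_geo9Y (d := d) (ℓ := ℓ) (hd := hd) (hL := hL) (b₀ := b₀) (b₁ := b₁) (Mstar := Mstar) (δ / 2) (half_pos hδ)
  set c' : ℝ := max c 0 with hc'
  have hc'0 : 0 ≤ c' := le_max_right _ _
  -- the (2.60) threshold and the perturbation constant
  set L : ℝ := ((ℓ + 1 : ℕ) : ℝ) with hLdef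
  set MT : ℝ := ((d : ℝ) + 3) * Real.log L / (δ * (2 * ((ℓ : ℝ) + 1) ^ 2 - 1)) with hMT
  have hden : 0 < δ * (2 * ((ℓ : ℝ) + 1) ^ 2 - 1) := mul_pos hδ (by nlinarith [(Nat.cast_nonneg ℓ : (0 : ℝ) ≤ ℓ)])
  -- the entry prefactor (linear in the majorant constant) and the Schur constant
  set Kb : ℝ := basisBound39 b * (‖(b.equivFunL : 𝔸 →L[ℝ] (Ff → ℝ))‖ / dimConstY' b) * (mN * Real.exp (2 * (δ * ((ℓ : ℝ) + 4)))) *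
    (((ℓ + 1 : ℕ) : ℝ)) ^ (((d : ℝ) + 3) / 2) with hKb
  have hKb0 : 0 ≤ Kb := by
    rw [hKb]
    have : 0 ≤ basisBound39 b := Finset.sum_nonneg fun _ _ => norm_nonneg _
    have := dimConstY'_pos b
    positivity
  set K' : ℝ := Kb * C * (Fintype.card Ff) * c' with hK'
  have hK'0 : 0 ≤ K' := by rw [hK']; exact mul_nonneg (mul_nonneg (mul_nonneg hKb0 hC) (Nat.cast_nonneg _)) hc'0
  set a₃ : ℝ := min (min a₀ a₂) (γ / (2 * (K' + 1))) with ha₃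
  have ha₃0 : 0 < a₃ := lt_min (lt_min ha₀ ha₂) (div_pos hγ (by positivity))
  refine ⟨max (max M₄ M₂) (max ML MT), a₃, γ / 2, lt_of_lt_of_le hM₄ ((le_max_left _ _).trans (le_max_left _ _)), ha₃0, half_pos hγ,
    fun x hM α₀ hα₀ hMa U hU hU' => ?_⟩
  have hM4 : M₄ ≤ (geo9Y x).M := ((le_max_left _ _).trans (le_max_left _ _)).trans hM
  have hM2 : M₂ ≤ (geo9Y x).M := ((le_max_right _ _).trans (le_max_left _ _)).trans hM
  have hMLx : ML ≤ (geo9Y x).M := ((le_max_left _ _).trans (le_max_right _ _)).trans hM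
  have hMTx : MT ≤ (geo9Y x).M := ((le_max_right _ _).trans (le_max_right _ _)).trans hM
  have hMa0 : (geo9Y x).M * α₀ ≤ a₀ := hMa.trans ((min_le_left _ _).trans (min_le_left _ _))
  have hMa2 : (geo9Y x).M * α₀ ≤ a₂ := hMa.trans ((min_le_left _ _).trans (min_le_right _ _))
  have hMaγ : (geo9Y x).M * α₀ ≤ γ / (2 * (K' + 1)) := hMa.trans (min_le_right _ _)
  have hMα0 : 0 ≤ (geo9Y x).M * α₀ := mul_nonneg (hM₄.le.trans hM4) hα₀.le
  have hS := hco x hM4 α₀ hα₀ hMa0 U hU hU'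
  have h0 := hmaj x hM2 α₀ hα₀ hMa2 U hU hU'
  -- the ONE class read: `G`-valuedness, from the displayed `MemOfFam G R₁`
  have hUG : ∀ μ y, U μ y ∈ G := mem_of_reg335R hG x hU
  have hpar := hparG x U hUG
  -- the (2.60) threshold in the member's spelling
  have hlog : ((d : ℝ) + 3) * Real.log (B9GeoNormsKLevelV1.geo9K x.toKIdx).L ≤ δ * (2 * ((ℓ : ℝ) + 1) ^ 2 - 1) * (geo9Y x).M := by
    have h1 : ((d : ℝ) + 3) * Real.log L = MT * (δ * (2 * ((ℓ : ℝ) + 1) ^ 2 - 1)) := by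
      rw [hMT, div_mul_cancel₀ _ hden.ne']
    have hLx : (B9GeoNormsKLevelV1.geo9K x.toKIdx).L = L := rfl
    rw [hLx, h1, mul_comm]
    exact mul_le_mul_of_nonneg_left hMTx hden.le
  -- the entries of the normalised difference
  have hCM : 0 ≤ C * ((geo9Y x).M * α₀) := mul_nonneg hC hMα0
  have hE : ∀ a e : (geo9Y x).Site × Ff,
      |(normMatY (X := (geo9Y x).Site) b (lamInvY x.toKIdx) (QGQOfY x.toKIdx (parB x) (T x) U) -
          normMatY (X := (geo9Y x).Site) b (lamInvY x.toKIdx) (QGQOfY x.toKIdx (parB x) (T₀ x) U)) a e| ≤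
        Kb * (C * ((geo9Y x).M * α₀)) * Real.exp (-(δ / 2 * (geo9Y x).dist a.1 e.1)) := by
    -- the difference of the normalised matrices IS the normalised matrix of the difference letter (linearity)
    have e0 : normMatY (X := (geo9Y x).Site) b (lamInvY x.toKIdx) (QGQOfY x.toKIdx (parB x) (T x) U) -
          normMatY (X := (geo9Y x).Site) b (lamInvY x.toKIdx) (QGQOfY x.toKIdx (parB x) (T₀ x) U) =
        normMatY (X := (geo9Y x).Site) b (lamInvY x.toKIdx) (QGQOfY x.toKIdx (parB x) (T x - T₀ x) U) := by
      rw [← normMatY_sub]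
      exact congrArg _ (QGQOfY_sub x.toKIdx (parB x) (T x) (T₀ x) U).symm
    intro a e
    have hK := abs_normMatY_QGQOfY_le_of_hasMajorant (κ := κ) x.toKIdx (instF := (inferInstance : Fintype (geo9Y x).Site))
      (instD := (inferInstance : DecidableEq (geo9Y x).Site)) bK b
      (B := bg9YR 𝔸 G R₁ R₂ x) (fun U => U) (T x - T₀ x) (parB x) U (hlev x) (hβ1 x) (hnbr x) hpar hCM hδ hlog h0 a e
    rw [e0, hKb]
    exact hK
  -- the form bound `K′(Mα₀)‖v‖² ≤ (γ/2)‖v‖²`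
  have hrow : ∀ y : (geo9Y x).Site, ∑ y', Real.exp (-(δ / 2 * (geo9Y x).dist y y')) ≤ c' := fun y => (hrow0 x hMLx y).trans (le_max_left _ _)
  have hform : ∀ v : (geo9Y x).Site × Ff → ℝ,
      |v ⬝ᵥ ((normMatY (X := (geo9Y x).Site) b (lamInvY x.toKIdx) (QGQOfY x.toKIdx (parB x) (T x) U) -
          normMatY (X := (geo9Y x).Site) b (lamInvY x.toKIdx) (QGQOfY x.toKIdx (parB x) (T₀ x) U)) *ᵥ v)| ≤ γ / 2 * (v ⬝ᵥ v) := by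
    intro v
    have h := form_abs_le_of_entry_decay (X := (geo9Y x).Site) (F := Ff)
      (normMatY (X := (geo9Y x).Site) b (lamInvY x.toKIdx) (QGQOfY x.toKIdx (parB x) (T x) U) -
        normMatY (X := (geo9Y x).Site) b (lamInvY x.toKIdx) (QGQOfY x.toKIdx (parB x) (T₀ x) U))
      (geo9Y x).dist (K := Kb * (C * ((geo9Y x).M * α₀))) (σ := δ / 2) (c := c')
      (mul_nonneg hKb0 (mul_nonneg hC hMα0)) (geo9Y_dist_comm x) hrow hE v
    refine h.trans (mul_le_mul_of_nonneg_right ?_ (Literature.LinearAlgebra.Matrix.dotProduct_self_nonneg_real v))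
    have h2 : Kb * (C * ((geo9Y x).M * α₀)) * (Fintype.card Ff) * c' = K' * ((geo9Y x).M * α₀) := by rw [hK']; ring
    rw [h2]
    have h3 : K' * ((geo9Y x).M * α₀) ≤ K' * (γ / (2 * (K' + 1))) := mul_le_mul_of_nonneg_left hMaγ hK'0
    have h4 : K' * (γ / (2 * (K' + 1))) ≤ γ / 2 := by
      rw [mul_div_assoc', div_le_div_iff₀ (by positivity) (by norm_num)]
      nlinarith
    exact h3.trans h4
  have hres := coercive_of_form_perturbation hS hform
  have hγ2 : γ - γ / 2 = γ / 2 := by ring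
  rw [hγ2] at hres
  exact hres

end Transfer

end Literature.MathematicalPhysics.QuantumFieldTheory.Balaban1983to89.B9Eq3132CoerciveFromGAR

end
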